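import Mathlib.NumberTheory.LSeries.ZetaZeros
import Literature.NumberTheory.LFunctions.SmoothedExplicitFormulaCharContour
import HarnessLib

/-!
# The penalised-maximal zero of `ζ(s)L(s, χ)` (Heath-Brown 1992, §6, choice of `ρ₀`)

Topic `Literature/NumberTheory/LFunctions`, sub-namespace `DHTest`. Everything here is PROVED
(no definitions).

Heath-Brown's Deuring–Heilbronn argument (§6, §8) tests a zero `ρ₀ = β₀ + iγ₀` of `ζ(s)L(s, χ₁)`
against the exceptional zero `β₁`; the inequality needs `Re F((s−ρ)L) ≥ 0` for the OTHER near
zeros, i.e. that none of them lies (essentially) to the right of `ρ₀` ("maximal" `ρ₀`, cf. §6 and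
Table/§9 "we suppose ρ has been chosen … maximal"). Since the heights are unbounded, we maximise a
penalised abscissa `Re ρ − κ|Im ρ|` over the finitely many zeros in a box:

* `finite_zeros_zeta_mul_L` — the zeros of `ζ · L(·, χ)` (`χ ≠ χ₀`) with `1/2 ≤ Re ρ`, `|Im ρ| ≤ Y`
  form a finite set;
* `exists_maximal_zero` — given a zero `ρ* ≠ β₁` with `1/2 ≤ Re ρ*`, `|Im ρ*| ≤ Y`, there is a zero
  `ρ₀ ≠ β₁` in the same box with `Re ρ* − κ|Im ρ*| ≤ Re ρ₀ − κ|Im ρ₀|` maximal among all such zeros.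

## References

* D. R. Heath-Brown, Proc. London Math. Soc. (3) 64 (1992), §6 (the choice of `ρ`) and §8.
  [cite: HeathBrown1992PLMS, Section 6]
-/

noncomputable section

open Complex Set

namespace Literature.NumberTheory.LFunctions

namespace DHTest

open ExplicitPsiChar

variable {q : ℕ} [NeZero q] {χ : DirichletCharacter ℂ q}

/-- The zeros of `ζ(s) L(s, χ)` (`χ ≠ χ₀`), other than a marked point `b`, with `1/2 ≤ Re ρ` and
`|Im ρ| ≤ Y`, form a finite set. [folklore] -/
theorem finite_zeros_zeta_mul_L (hχ : χ ≠ 1) (b : ℂ) (Y : ℝ) :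
    {ρ : ℂ | (riemannZeta ρ = 0 ∨ χ.LFunction ρ = 0) ∧ ρ ≠ b ∧ 1 / 2 ≤ ρ.re ∧ |ρ.im| ≤ Y}.Finite := by
  set K : Set ℂ := Icc (1 / 2 : ℝ) 1 ×ℂ Icc (-Y) Y with hK
  have hKc : IsCompact K := isCompact_Icc.reProdIm isCompact_Icc
  refine ((hKc.inter_riemannZetaZeros_finite).union (finite_inter_zeros_of_isCompact hχ hKc)).subset ?_
  rintro ρ ⟨hz, -, hre, him⟩
  rcases hz with h | h
  · refine Or.inl ⟨?_, h⟩
    exact Complex.mem_reProdIm.2 ⟨⟨hre, (re_lt_one_of_riemannZeta_eq_zero h).le⟩, abs_le.1 him⟩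
  · refine Or.inr ⟨?_, h⟩
    refine Complex.mem_reProdIm.2 ⟨⟨hre, ?_⟩, abs_le.1 him⟩
    by_contra h1
    exact DirichletCharacter.LFunction_ne_zero_of_one_le_re χ (Or.inl hχ) (not_le.1 h1).le h

/-- **The penalised-maximal zero.** For `χ ≠ χ₀`, `κ`, `Y` real, a marked point `b` and a zero `ρ*`
of `ζ · L(·, χ)` with `ρ* ≠ b`, `1/2 ≤ Re ρ*`, `|Im ρ*| ≤ Y`: there is a zero `ρ₀` of `ζ · L(·, χ)` with
`ρ₀ ≠ b`, `1/2 ≤ Re ρ₀`, `|Im ρ₀| ≤ Y`, `Re ρ* − κ|Im ρ*| ≤ Re ρ₀ − κ|Im ρ₀|`, and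
`Re ρ − κ|Im ρ| ≤ Re ρ₀ − κ|Im ρ₀|` for every such zero `ρ`. [cite: HeathBrown1992PLMS, Section 6 (choice of ρ)] -/
theorem exists_maximal_zero (hχ : χ ≠ 1) (b : ℂ) (κ Y : ℝ) {ρs : ℂ}
    (hρs : riemannZeta ρs = 0 ∨ χ.LFunction ρs = 0) (hne : ρs ≠ b) (hre : 1 / 2 ≤ ρs.re)
    (him : |ρs.im| ≤ Y) :
    ∃ ρ₀ : ℂ, (riemannZeta ρ₀ = 0 ∨ χ.LFunction ρ₀ = 0) ∧ ρ₀ ≠ b ∧ 1 / 2 ≤ ρ₀.re ∧ |ρ₀.im| ≤ Y ∧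
      ρs.re - κ * |ρs.im| ≤ ρ₀.re - κ * |ρ₀.im| ∧
      ∀ ρ : ℂ, (riemannZeta ρ = 0 ∨ χ.LFunction ρ = 0) → ρ ≠ b → 1 / 2 ≤ ρ.re → |ρ.im| ≤ Y →
        ρ.re - κ * |ρ.im| ≤ ρ₀.re - κ * |ρ₀.im| := by
  classical
  have hfin := finite_zeros_zeta_mul_L hχ b Y
  set E := hfin.toFinset with hE
  have hmem : ∀ {ρ : ℂ}, ρ ∈ E ↔ (riemannZeta ρ = 0 ∨ χ.LFunction ρ = 0) ∧ ρ ≠ b ∧ 1 / 2 ≤ ρ.re ∧ |ρ.im| ≤ Y := by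
    intro ρ; rw [hE, Set.Finite.mem_toFinset]; rfl
  have hne' : E.Nonempty := ⟨ρs, hmem.2 ⟨hρs, hne, hre, him⟩⟩
  obtain ⟨ρ₀, hρ₀, hmax⟩ := E.exists_max_image (fun ρ : ℂ ↦ ρ.re - κ * |ρ.im|) hne'
  obtain ⟨h1, h2, h3, h4⟩ := hmem.1 hρ₀
  exact ⟨ρ₀, h1, h2, h3, h4, hmax ρs (hmem.2 ⟨hρs, hne, hre, him⟩),
    fun ρ hz hb hr hi ↦ hmax ρ (hmem.2 ⟨hz, hb, hr, hi⟩)⟩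

/-- **Consequences of penalised maximality** with `κ = 1/(Y₀ L)`: if `|Im ρ*| ≤ Y₀`, then
`(1 − Re ρ₀)L ≤ (1 − Re ρ*)L + 1`, `|Im ρ₀| ≤ ((1 − Re ρ*)L + 1)·Y₀`, and every admissible zero
`ρ` with `|Im ρ| ≤ |Im ρ₀| + δ` has `Re ρ ≤ Re ρ₀ + δ/(Y₀L)`. [folklore] -/
theorem maximality_consequences {Y₀ L δ : ℝ} (hY₀ : 0 < Y₀) (hL : 0 < L) {ρs ρ₀ : ℂ}
    (hs : |ρs.im| ≤ Y₀) (hρ₀1 : ρ₀.re ≤ 1)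
    (hmax₀ : ρs.re - 1 / (Y₀ * L) * |ρs.im| ≤ ρ₀.re - 1 / (Y₀ * L) * |ρ₀.im|) :
    (1 - ρ₀.re) * L ≤ (1 - ρs.re) * L + 1 ∧
      |ρ₀.im| ≤ ((1 - ρs.re) * L + 1) * Y₀ ∧
      ∀ ρ : ℂ, ρ.re - 1 / (Y₀ * L) * |ρ.im| ≤ ρ₀.re - 1 / (Y₀ * L) * |ρ₀.im| →
        |ρ.im| ≤ |ρ₀.im| + δ → ρ.re ≤ ρ₀.re + δ / (Y₀ * L) := by
  have hκ : 0 < 1 / (Y₀ * L) := by positivity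
  have hκY : 1 / (Y₀ * L) * |ρs.im| ≤ 1 / L := by
    rw [div_mul_eq_mul_div, one_mul, div_le_div_iff₀ (by positivity) hL]
    nlinarith [abs_nonneg ρs.im]
  have h0 : 0 ≤ 1 / (Y₀ * L) * |ρ₀.im| := by positivity
  refine ⟨?_, ?_, ?_⟩
  · -- `1 - β₀ ≤ 1 - β* + κ|γ*| ≤ 1 - β* + 1/L`
    have : 1 - ρ₀.re ≤ 1 - ρs.re + 1 / L := by linarith
    have := mul_le_mul_of_nonneg_right this hL.le
    rw [add_mul, one_div_mul_cancel hL.ne'] at this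
    exact this
  · -- `κ|γ₀| ≤ (1 - β*) + κ|γ*| ≤ (1 - β*) + 1/L`
    have h1 : 1 / (Y₀ * L) * |ρ₀.im| ≤ (1 - ρs.re) + 1 / L := by linarith
    rw [div_mul_eq_mul_div, one_mul, div_le_iff₀ (by positivity)] at h1
    have e : (1 - ρs.re + 1 / L) * (Y₀ * L) = ((1 - ρs.re) * L + 1) * Y₀ := by field_simp
    linarith
  · intro ρ hρ hi
    have h1 : ρ.re ≤ ρ₀.re + 1 / (Y₀ * L) * (|ρ.im| - |ρ₀.im|) := by linarith
    have h2 : 1 / (Y₀ * L) * (|ρ.im| - |ρ₀.im|) ≤ 1 / (Y₀ * L) * δ :=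
      mul_le_mul_of_nonneg_left (by linarith) hκ.le
    have e : 1 / (Y₀ * L) * δ = δ / (Y₀ * L) := by ring
    linarith

end DHTest

end Literature.NumberTheory.LFunctions

end
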